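import Summits.QuantumFields.YangMills.Theorems.LangevinControlUVOSLegsAtWeakCouplingCInheritedAmplitudeGatesDefs
import Summits.QuantumFields.YangMills.Theorems.LangevinControlUVOSLegsFromFemtoAndGapStubPinAux
import HarnessLib

/-!
# Stub `stub_tame` of line `inherited-amplitude-gates` (crux `OSLegsAtWeakCouplingC`, stmt-QuantumFields-16207): the `FitWindow` conjunct isolated

Support file of the stub-worker audit of the registered stub
`stub_tame : … → Continuous a → TwoPoint G r a → Skewness G r a → GapInUnits G r a → FlatShape2 G r a ∧ FitWindow G r a`
of the skeleton `Cruxes/OSLegsAtWeakCouplingC/Lines/inherited_amplitude_gates.lean` (lead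
`prover-line-stmt-QuantumFields-16207-a1-0`).  The stub itself is ENGINE-GRADE (audit `work/stubs/stub_tame.audit.md`);
this file settles exactly what its second conjunct `FitWindow` adds to H1 for a continuous unit map:

* `StubTame.exists_sweep` — window sweeping (real analysis): a continuous `g → 0` at `+∞` with `g B ≥ s₂ > s₁ > 0`
  runs monotonically-enough through `[s₁, s₂]`: there are `B ≤ β₁ ≤ β₂` with `g β₁ = s₂`, `g β₂ = s₁` and
  `g([β₁, β₂]) ⊆ [s₁, s₂]` (last exit from `{g ≥ s₂}`, first entry into `{g ≤ s₁}`, intermediate value theorem);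
* `StubTame.fitWindow_of_growthWindow` (binder form `…'`) — H1's box clause (witnesses `Γ, β₀, ℓ₀, c, C`) ∧ `Continuous a` ∧
  GROWTH WINDOWS of the shape function (`∀ K t > 0 ∃ 0 < s₁ < s₂ ≤ t, K s⁸ ≤ Γ(s)` on `[s₁, s₂]`) ⟹ `FitWindow G r a`
  (torus `L = 8N`, `N = ⌈s₂ / max a⌉`, the swept β-window of `exists_sweep`, H1's LOWER axis bound);
* `StubTame.growthWindow_of_fitWindow` (binder form `…'`) — conversely `FitWindow G r a` ∧ H1's box clause ∧ `Continuous a` ⟹ growth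
  windows of `Γ` (H1's UPPER axis bound on the fitted window, intermediate value theorem) — the extraction the lead's
  `stub_inherit` performs inline.

So, given H1 and `Continuous a`, `FitWindow` is EQUIVALENT to "`Γ` is not `O(s⁸)` on windows at `0⁺`" — the growth
clause the predecessor line's `FC2` carried as `Γ(s)/s⁸ → ∞` — and is therefore NOT a consequence of H1's logical form
(abstract countermodel `Γ(s) = (s/ℓ₀)⁹`, pinning clause included), nor refutable (no H1 witness for a compact simple `G`,
Disproof §1): engine-grade (fixed-torus two-sided `β⁻²` asymptotics `AxisLowerFixedTorus` + a unit map `o(β^{-1/4})`).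
-/

set_option autoImplicit false

noncomputable section

open MeasureTheory Filter Topology
open Literature.MathematicalPhysics.QuantumFieldTheory Literature.MathematicalPhysics.QuantumLattice
open Literature.MathematicalPhysics.AQFT Literature.Probability.LatticeModels
open Summit.QuantumFields.YangMills.Cruxes.OSLegsFromFemtoAndGap.DlrCollarTransfer
open Summit.QuantumFields.YangMills.Theorems.OSLegsFromFemtoAndGap (exists_forall_le_of_tendsto_zero)

namespace Summit.QuantumFields.YangMills.Cruxes.OSLegsAtWeakCouplingC.InheritedAmplitudeGates

namespace StubTame

/-! ## §1 Real analysis: sweeping a window of scales by the coupling -/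

/-- **Window sweeping.**  Let `g` be continuous with `g → 0` at `+∞`, `0 < s₁ < s₂ ≤ g B`.  Then there are couplings
`B ≤ β₁ ≤ β₂` with `g β₁ = s₂`, `g β₂ = s₁` and `s₁ ≤ g ≤ s₂` on `[β₁, β₂]`: `β₁` is the last coupling in `[B, B']`
(`g B' < s₁`) with `g ≥ s₂`, `β₂` the first one after `β₁` with `g ≤ s₁` (compactness), the end values by the
intermediate value theorem. -/
theorem exists_sweep {g : ℝ → ℝ} (hg : Continuous g) (hlim : Tendsto g atTop (𝓝 0)) {B s₁ s₂ : ℝ}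
    (hs₁ : 0 < s₁) (hs : s₁ < s₂) (hB : s₂ ≤ g B) :
    ∃ β₁ β₂ : ℝ, B ≤ β₁ ∧ β₁ ≤ β₂ ∧ g β₁ = s₂ ∧ g β₂ = s₁ ∧
      ∀ β : ℝ, β₁ ≤ β → β ≤ β₂ → s₁ ≤ g β ∧ g β ≤ s₂ := by
  -- a coupling `B' ≥ B` with `g B' < s₁`
  obtain ⟨B₀, hB₀⟩ := Filter.eventually_atTop.1 (hlim (Iio_mem_nhds hs₁))
  have hgB' : g (max B B₀) < s₁ := hB₀ _ (le_max_right _ _)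
  have hBB' : B ≤ max B B₀ := le_max_left _ _
  -- `β₁` : the greatest coupling in `[B, B']` with `g ≥ s₂`
  obtain ⟨β₁, hβ₁S, hβ₁max⟩ :=
    (isCompact_Icc.inter_right (isClosed_Ici.preimage hg) :
      IsCompact (Set.Icc B (max B B₀) ∩ g ⁻¹' Set.Ici s₂)).exists_isGreatest ⟨B, ⟨le_rfl, hBB'⟩, hB⟩
  have hBβ₁ : B ≤ β₁ := hβ₁S.1.1
  have hβ₁B' : β₁ ≤ max B B₀ := hβ₁S.1.2
  have hgβ₁ : s₂ ≤ g β₁ := hβ₁S.2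
  have hlt₂ : ∀ β : ℝ, β₁ < β → β ≤ max B B₀ → g β < s₂ := by
    intro β h1 h2
    by_contra hge
    have hmem : β ∈ Set.Icc B (max B B₀) ∩ g ⁻¹' Set.Ici s₂ := ⟨⟨hBβ₁.trans h1.le, h2⟩, not_lt.1 hge⟩
    exact absurd (hβ₁max hmem) (not_le.2 h1)
  have hgβ₁eq : g β₁ = s₂ := by
    obtain ⟨β, hβI, hβs⟩ :=
      intermediate_value_Icc' hβ₁B' hg.continuousOn ⟨(hgB'.trans hs).le, hgβ₁⟩
    have hmem : β ∈ Set.Icc B (max B B₀) ∩ g ⁻¹' Set.Ici s₂ :=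
      ⟨⟨hBβ₁.trans hβI.1, hβI.2⟩, (le_of_eq hβs.symm : s₂ ≤ g β)⟩
    have heq : β = β₁ := le_antisymm (hβ₁max hmem) hβI.1
    rw [← heq]
    exact hβs
  -- `β₂` : the least coupling in `[β₁, B']` with `g ≤ s₁`
  obtain ⟨β₂, hβ₂T, hβ₂min⟩ :=
    (isCompact_Icc.inter_right (isClosed_Iic.preimage hg) :
      IsCompact (Set.Icc β₁ (max B B₀) ∩ g ⁻¹' Set.Iic s₁)).exists_isLeast ⟨max B B₀, ⟨hβ₁B', le_rfl⟩, hgB'.le⟩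
  have hβ₁₂ : β₁ ≤ β₂ := hβ₂T.1.1
  have hβ₂B' : β₂ ≤ max B B₀ := hβ₂T.1.2
  have hgβ₂ : g β₂ ≤ s₁ := hβ₂T.2
  have hgt₁ : ∀ β : ℝ, β₁ ≤ β → β < β₂ → s₁ < g β := by
    intro β h1 h2
    by_contra hle
    have hmem : β ∈ Set.Icc β₁ (max B B₀) ∩ g ⁻¹' Set.Iic s₁ := ⟨⟨h1, h2.le.trans hβ₂B'⟩, not_lt.1 hle⟩
    exact absurd (hβ₂min hmem) (not_le.2 h2)
  have hgβ₂eq : g β₂ = s₁ := by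
    obtain ⟨β, hβI, hβs⟩ :=
      intermediate_value_Icc' hβ₁₂ hg.continuousOn ⟨hgβ₂, by rw [hgβ₁eq]; exact hs.le⟩
    have hmem : β ∈ Set.Icc β₁ (max B B₀) ∩ g ⁻¹' Set.Iic s₁ :=
      ⟨⟨hβI.1, hβI.2.trans hβ₂B'⟩, (le_of_eq hβs : g β ≤ s₁)⟩
    have heq : β = β₂ := le_antisymm hβI.2 (hβ₂min hmem)
    rw [← heq]
    exact hβs
  refine ⟨β₁, β₂, hBβ₁, hβ₁₂, hgβ₁eq, hgβ₂eq, fun β h1 h2 => ⟨?_, ?_⟩⟩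
  · rcases eq_or_lt_of_le h2 with h | h
    · rw [h, hgβ₂eq]
    · exact (hgt₁ β h1 h).le
  · rcases eq_or_lt_of_le h1 with h | h
    · rw [← h, hgβ₁eq]
    · exact (hlt₂ β h (h2.trans hβ₂B')).le

/-! ## §2 `FitWindow` from growth windows of H1's shape function -/

/-- **`FitWindow` from growth windows of the shape function.**  Let `a` be a continuous unit map and
`Γ, β₀, ℓ₀, c, C` witnesses of H1's data (`0 < ℓ₀`, `0 < c`, `a > 0`, `a → 0`, and the verbatim femto-box clause of
`TwoPoint` on all tori `L a(β) ≤ ℓ₀`, `β ≥ β₀`).  If `Γ` has GROWTH WINDOWS at `0⁺` — for every `K` and every `t > 0`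
some `0 < s₁ < s₂ ≤ t` with `K s⁸ ≤ Γ(s)` on `[s₁, s₂]` — then `FitWindow G r a` holds: given `(K, β', ℓ')` take the
growth window of `K / c` below `min ℓ₀ ℓ' / 8`, the maximum `M` of `a` beyond `max β' β₀`, `N = ⌈s₂ / M⌉`, the torus
`L = 8N` and the β-window swept by `N a(β)` through `[s₁, s₂]` (`exists_sweep`; `a β₁ ≠ a β₂` because the end scales
differ); on it `8 N a(β) ≤ min ℓ₀ ℓ'` and H1's lower axis bound gives `N⁸ Cov ≥ c Γ(N a β) ≥ K (N a β)⁸`. -/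
theorem fitWindow_of_growthWindow' (G : Type) [Group G] [TopologicalSpace G] [IsTopologicalGroup G]
    [CompactSpace G] [MeasurableSpace G] [BorelSpace G] (r : LatticeRep G) (a : ℝ → ℝ)
    (ha : Continuous a) {Γ : ℝ → ℝ} {β₀ ℓ₀ c C : ℝ} (hℓ₀ : 0 < ℓ₀) (hc : 0 < c)
    (hpos : ∀ β, 0 < a β) (hlim : Filter.Tendsto a Filter.atTop (nhds 0))
    (hbox : ∀ (L : ℕ) [NeZero L] (β : ℝ), β₀ ≤ β → (L : ℝ) * a β ≤ ℓ₀ → let P : (Fin 4 → ZMod L) → Fin 4 → Fin 4 → GaugeConfig 4 L G → ℝ := fun x i j U => (r.N : ℝ) - (r.ρ (plaquetteHolonomy U x i j)).trace.re; let E : (GaugeConfig 4 L G → ℝ) → ℝ := fun F => wilsonExpectation (d := 4) (L := L) r.ρ β F; let cov : (GaugeConfig 4 L G → ℝ) → (GaugeConfig 4 L G → ℝ) → ℝ := fun F F' => E (fun U => F U * F' U) - E F * E F'; let dist : (Fin 4 → ZMod L) → (Fin 4 → ZMod L) → ℝ := fun x y => Real.sqrt (∑ k : Fin 4, (((x k -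 y k).valMinAbs : ℤ) : ℝ) ^ 2); (∀ n : ℕ, 1 ≤ n → 8 * n ≤ L → c * Γ ((n : ℝ) * a β) ≤ (n : ℝ) ^ 8 * cov (P 0 0 1) (P (Pi.single (2 : Fin 4) ((n : ℕ) : ZMod L)) 0 1) ∧ (n : ℝ) ^ 8 * cov (P 0 0 1) (P (Pi.single (2 : Fin 4) ((n : ℕ) : ZMod L)) 0 1) ≤ C * Γ ((n : ℝ) * a β)) ∧ (∀ (x y : Fin 4 → ZMod L) (i j i' j' : Fin 4), x ≠ y → i ≠ j → i' ≠ j' → |cov (P x i j) (P y i' j')| * dist x y ^ 8 ≤ C * Γ (dist x y * a β)))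
    (hgrow : ∀ K t : ℝ, 0 < t → ∃ s₁ s₂ : ℝ, 0 < s₁ ∧ s₁ < s₂ ∧ s₂ ≤ t ∧
      ∀ s : ℝ, s₁ ≤ s → s ≤ s₂ → K * s ^ 8 ≤ Γ s) :
    FitWindow G r a := by
  intro K β' ℓ' hℓ'
  -- the window of scales on which `Γ ≥ (K / c) s⁸`, inside `(0, min ℓ₀ ℓ' / 8]`
  have ht : 0 < min ℓ₀ ℓ' / 8 := div_pos (lt_min hℓ₀ hℓ') (by norm_num)
  obtain ⟨s₁, s₂, hs₁, hs₁₂, hs₂t, hΓ⟩ := hgrow (K / c) (min ℓ₀ ℓ' / 8) ht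
  -- the maximum of `a` beyond `max β' β₀` and the separation `N = ⌈s₂ / max a⌉`
  obtain ⟨βM, hβM, hM⟩ := exists_forall_le_of_tendsto_zero ha hpos hlim (max β' β₀)
  have hMpos : 0 < a βM := hpos βM
  obtain ⟨N, hN1, hs₂N⟩ : ∃ N : ℕ, 1 ≤ N ∧ s₂ ≤ (N : ℝ) * a βM := by
    refine ⟨⌈s₂ / a βM⌉₊,
      Nat.one_le_iff_ne_zero.2 (Nat.ceil_pos.2 (div_pos (hs₁.trans hs₁₂) hMpos)).ne', ?_⟩
    have h := Nat.le_ceil (s₂ / a βM)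
    rw [div_le_iff₀ hMpos] at h
    exact h
  -- sweep the β-window on which `N a β` runs through `[s₁, s₂]`
  have hg : Continuous fun β => (N : ℝ) * a β := continuous_const.mul ha
  have hglim : Tendsto (fun β => (N : ℝ) * a β) atTop (𝓝 0) := by
    simpa using hlim.const_mul (N : ℝ)
  obtain ⟨β₁, β₂, hMβ₁, hβ₁₂, hg₁, hg₂, hwin⟩ := exists_sweep hg hglim (B := βM) hs₁ hs₁₂ hs₂N
  haveI : NeZero (8 * N) := ⟨by omega⟩
  refine ⟨8 * N, inferInstance, β₁, β₂, N, (le_max_left β' β₀).trans (hβM.trans hMβ₁), hβ₁₂, ?_, hN1,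
    le_rfl, fun β hβ₁ hβ₂ => ?_⟩
  · intro heq
    have h : s₂ = s₁ := by rw [← hg₁, ← hg₂]; simp only [heq]
    exact absurd h (ne_of_gt hs₁₂)
  · obtain ⟨hlo, hhi⟩ := hwin β hβ₁ hβ₂
    have hβ₀ : β₀ ≤ β := (le_max_right β' β₀).trans (hβM.trans (hMβ₁.trans hβ₁))
    have h8 : 8 * ((N : ℝ) * a β) ≤ min ℓ₀ ℓ' := by
      have h := hhi.trans hs₂t
      linarith
    have hmin₀ := min_le_left ℓ₀ ℓ'
    have hmin' := min_le_right ℓ₀ ℓ'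
    have hL' : ((8 * N : ℕ) : ℝ) * a β ≤ ℓ' := by push_cast; linarith
    have hL₀ : ((8 * N : ℕ) : ℝ) * a β ≤ ℓ₀ := by push_cast; linarith
    refine ⟨hL', ?_⟩
    obtain ⟨hax, -⟩ := hbox (8 * N) β hβ₀ hL₀
    have hlow := (hax N hN1 le_rfl).1
    have hKΓ : K / c * ((N : ℝ) * a β) ^ 8 ≤ Γ ((N : ℝ) * a β) := hΓ _ hlo hhi
    have hK : K * ((N : ℝ) * a β) ^ 8 ≤ c * Γ ((N : ℝ) * a β) := by
      have h := mul_le_mul_of_nonneg_left hKΓ hc.le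
      have hc0 : c ≠ 0 := hc.ne'
      calc K * ((N : ℝ) * a β) ^ 8 = c * (K / c * ((N : ℝ) * a β) ^ 8) := by field_simp
        _ ≤ c * Γ ((N : ℝ) * a β) := h
    exact hK.trans hlow

/-! ## §3 Conversely: growth windows of the shape function from `FitWindow` -/

/-- **Growth windows from `FitWindow`.**  Let `a` be a continuous unit map and `Γ, β₀, ℓ₀, c, C` witnesses of H1's
data (`0 < ℓ₀`, `0 < c`, `a > 0`, `Γ > 0` on `(0, ℓ₀]`, the verbatim femto-box clause).  If `FitWindow G r a` holds,
then `Γ` has growth windows at `0⁺`: given `K`, `t > 0`, the fit of `K·C` beyond `β₀` in the femto range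
`min ℓ₀ (8t)` produces a torus `L`, a separation `n` and a window `[β₁, β₂]` with `a β₁ ≠ a β₂` on which
`K C (n a β)⁸ ≤ n⁸ Cov ≤ C Γ(n a β)` (H1's UPPER axis bound; `C ≥ c > 0`); the swept scales `n a(β)` cover the
non-degenerate interval between `n a β₁` and `n a β₂` (intermediate value theorem), inside `(0, t]`. -/
theorem growthWindow_of_fitWindow' (G : Type) [Group G] [TopologicalSpace G] [IsTopologicalGroup G]
    [CompactSpace G] [MeasurableSpace G] [BorelSpace G] (r : LatticeRep G) (a : ℝ → ℝ)
    (ha : Continuous a) {Γ : ℝ → ℝ} {β₀ ℓ₀ c C : ℝ} (hℓ₀ : 0 < ℓ₀) (hc : 0 < c)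
    (hpos : ∀ β, 0 < a β) (hΓ : ∀ s : ℝ, 0 < s → s ≤ ℓ₀ → 0 < Γ s)
    (hbox : ∀ (L : ℕ) [NeZero L] (β : ℝ), β₀ ≤ β → (L : ℝ) * a β ≤ ℓ₀ → let P : (Fin 4 → ZMod L) → Fin 4 → Fin 4 → GaugeConfig 4 L G → ℝ := fun x i j U => (r.N : ℝ) - (r.ρ (plaquetteHolonomy U x i j)).trace.re; let E : (GaugeConfig 4 L G → ℝ) → ℝ := fun F => wilsonExpectation (d := 4) (L := L) r.ρ β F; let cov : (GaugeConfig 4 L G → ℝ) → (GaugeConfig 4 L G → ℝ) → ℝ := fun F F' => E (fun U => F U * F' U) - E F * E F'; let dist : (Fin 4 → ZMod L) → (Fin 4 → ZMod L) → ℝ := fun x y => Real.sqrt (∑ k : Fin 4, (((x k - y k).valMinAbs : ℤ) : ℝ) ^ 2); (∀ n : ℕ, 1 ≤ n → 8 * n ≤ L → c * Γ ((n : ℝ) * a β) ≤ (n : ℝ) ^ 8 * cov (P 0 0 1) (P (Pi.single (2 : Fin 4) ((n : ℕ) : ZMod L)) 0 1) ∧ (n : ℝ) ^ 8 * cov (P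 0 0 1) (P (Pi.single (2 : Fin 4) ((n : ℕ) : ZMod L)) 0 1) ≤ C * Γ ((n : ℝ) * a β)) ∧ (∀ (x y : Fin 4 → ZMod L) (i j i' j' : Fin 4), x ≠ y → i ≠ j → i' ≠ j' → |cov (P x i j) (P y i' j')| * dist x y ^ 8 ≤ C * Γ (dist x y * a β)))
    (hfit : FitWindow G r a) :
    ∀ K t : ℝ, 0 < t → ∃ s₁ s₂ : ℝ, 0 < s₁ ∧ s₁ < s₂ ∧ s₂ ≤ t ∧
      ∀ s : ℝ, s₁ ≤ s → s ≤ s₂ → K * s ^ 8 ≤ Γ s := by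
  intro K t ht
  have hℓ' : 0 < min ℓ₀ (8 * t) := lt_min hℓ₀ (by linarith)
  obtain ⟨L, hL, β₁, β₂, n, hβ₀, hβ₁₂, hne, hn1, hnL, hwin⟩ := hfit (K * C) β₀ (min ℓ₀ (8 * t)) hℓ'
  have hnpos : (0 : ℝ) < n := by exact_mod_cast hn1
  have hnL' : 8 * (n : ℝ) ≤ L := by exact_mod_cast hnL
  have hgne : (n : ℝ) * a β₁ ≠ (n : ℝ) * a β₂ := fun h => hne (mul_left_cancel₀ hnpos.ne' h)
  -- on the window: the scale is `≤ t`, `≤ ℓ₀`, and `K C (n a β)⁸ ≤ C Γ(n a β)`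
  have hkey : ∀ β : ℝ, β₁ ≤ β → β ≤ β₂ → (n : ℝ) * a β ≤ t ∧ (n : ℝ) * a β ≤ ℓ₀ ∧
      c * Γ ((n : ℝ) * a β) ≤ C * Γ ((n : ℝ) * a β) ∧ K * C * ((n : ℝ) * a β) ^ 8 ≤ C * Γ ((n : ℝ) * a β) := by
    intro β h1 h2
    obtain ⟨hLa, hKC⟩ := hwin β h1 h2
    have hLa₀ : (L : ℝ) * a β ≤ ℓ₀ := hLa.trans (min_le_left _ _)
    have hLat : (L : ℝ) * a β ≤ 8 * t := hLa.trans (min_le_right _ _)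
    have haβ : 0 < a β := hpos β
    have hgL : 8 * ((n : ℝ) * a β) ≤ (L : ℝ) * a β := by nlinarith
    haveI : NeZero L := hL
    obtain ⟨hax, -⟩ := hbox L β (hβ₀.trans h1) hLa₀
    obtain ⟨hlo, hup⟩ := hax n hn1 hnL
    exact ⟨by linarith, by linarith, hlo.trans hup, hKC.trans hup⟩
  -- `C > 0` (the sandwich at `β₁` with `Γ > 0`, `c > 0`)
  have hCpos : 0 < C := by
    obtain ⟨-, hℓ₁, hcC, -⟩ := hkey β₁ le_rfl hβ₁₂
    have hΓpos : 0 < Γ ((n : ℝ) * a β₁) := hΓ _ (mul_pos hnpos (hpos β₁)) hℓ₁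
    by_contra hle
    have h1 : C * Γ ((n : ℝ) * a β₁) ≤ 0 := mul_nonpos_of_nonpos_of_nonneg (not_lt.1 hle) hΓpos.le
    have h2 : 0 < c * Γ ((n : ℝ) * a β₁) := mul_pos hc hΓpos
    linarith
  refine ⟨min ((n : ℝ) * a β₁) ((n : ℝ) * a β₂), max ((n : ℝ) * a β₁) ((n : ℝ) * a β₂),
    lt_min (mul_pos hnpos (hpos β₁)) (mul_pos hnpos (hpos β₂)), min_lt_max.2 hgne,
    max_le (hkey β₁ le_rfl hβ₁₂).1 (hkey β₂ hβ₁₂ le_rfl).1, fun s hs₁ hs₂ => ?_⟩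
  -- intermediate value theorem: `s = n a β` for some `β ∈ [β₁, β₂]`
  obtain ⟨β, hβI, hβs⟩ : s ∈ (fun β => (n : ℝ) * a β) '' Set.Icc β₁ β₂ := by
    have hcont : ContinuousOn (fun β => (n : ℝ) * a β) (Set.Icc β₁ β₂) :=
      (continuous_const.mul ha).continuousOn
    rcases le_total ((n : ℝ) * a β₁) ((n : ℝ) * a β₂) with h | h
    · rw [min_eq_left h] at hs₁
      rw [max_eq_right h] at hs₂
      exact intermediate_value_Icc hβ₁₂ hcont ⟨hs₁, hs₂⟩
    · rw [min_eq_right h] at hs₁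
      rw [max_eq_left h] at hs₂
      exact intermediate_value_Icc' hβ₁₂ hcont ⟨hs₁, hs₂⟩
  obtain ⟨-, -, -, hKC⟩ := hkey β hβI.1 hβI.2
  have hβs' : (n : ℝ) * a β = s := hβs
  rw [hβs'] at hKC
  have h : C * (K * s ^ 8) ≤ C * Γ s := by
    calc C * (K * s ^ 8) = K * C * s ^ 8 := by ring
      _ ≤ C * Γ s := hKC
  exact le_of_mul_le_mul_left h hCpos

/-! ## §4 The registered sub-goals (closed forms) -/

/-- **`FitWindow` from growth windows of H1's shape function — registered sub-goal `fitWindow_of_growthWindow` of crux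
stmt-QuantumFields-16207 (line `inherited-amplitude-gates`, stub `stub_tame`), closed form.**  For every compact `G`,
faithful lattice representation `r`, CONTINUOUS unit map `a` and H1 witnesses `Γ, β₀, ℓ₀, c, C` (`0 < ℓ₀`, `0 < c`,
`a > 0`, `a → 0`, the verbatim femto-box clause of `TwoPoint`): growth windows of `Γ` at `0⁺`
(`∀ K t > 0 ∃ 0 < s₁ < s₂ ≤ t, K s⁸ ≤ Γ s` on `[s₁, s₂]`) imply `FitWindow G r a` (`fitWindow_of_growthWindow'`). -/
theorem fitWindow_of_growthWindow : ∀ (G : Type) [Group G] [TopologicalSpace G] [IsTopologicalGroup G] [CompactSpace G] [MeasurableSpace G] [BorelSpace G] (r : LatticeRep G) (a Γ : ℝ → ℝ) (β₀ ℓ₀ c C : ℝ), Continuous a → 0 < ℓ₀ → 0 < c → (∀ β, 0 < a β) → Filter.Tendsto a Filter.atTop (nhds 0) → (∀ (L : ℕ) [NeZero L] (β : ℝ), β₀ ≤ β → (L : ℝ) * a β ≤ ℓ₀ → let P : (Fin 4 → ZMod L) → Fin 4 → Fin 4 → GaugeConfig 4 L G → ℝ := fun x i j U => (r.N : ℝ)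 - (r.ρ (plaquetteHolonomy U x i j)).trace.re; let E : (GaugeConfig 4 L G → ℝ) → ℝ := fun F => wilsonExpectation (d := 4) (L := L) r.ρ β F; let cov : (GaugeConfig 4 L G → ℝ) → (GaugeConfig 4 L G → ℝ) → ℝ := fun F F' => E (fun U => F U * F' U) - E F * E F'; let dist : (Fin 4 → ZMod L) → (Fin 4 → ZMod L) → ℝ := fun x y => Real.sqrt (∑ k : Fin 4, (((x k - y k).valMinAbs : ℤ) : ℝ) ^ 2); (∀ n : ℕ, 1 ≤ n → 8 * n ≤ L → c * Γ ((n : ℝ) * a β) ≤ (n : ℝ) ^ 8 * cov (P 0 0 1) (P (Pi.single (2 : Fin 4) ((n : ℕ) : ZMod L)) 0 1) ∧ (n : ℝ) ^ 8 * cov (P 0 0 1) (P (Pi.single (2 : Fin 4) ((n : ℕ) : ZMod L)) 0 1) ≤ C * Γ ((n : ℝ) * a β)) ∧ (∀ (x y : Fin 4 → ZMod L) (i j i' j' : Fin 4), x ≠ y → i ≠ j → i' ≠ j' → |cov (P x i j) (P y i' j')| * dist x y ^ 8 ≤ C * Γ (dist x y * a β))) → (∀ K t : ℝ, 0 < t →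 ∃ s₁ s₂ : ℝ, 0 < s₁ ∧ s₁ < s₂ ∧ s₂ ≤ t ∧ ∀ s : ℝ, s₁ ≤ s → s ≤ s₂ → K * s ^ 8 ≤ Γ s) → FitWindow G r a := by
  intro G _ _ _ _ _ _ r a Γ β₀ ℓ₀ c C ha hℓ₀ hc hpos hlim hbox hgrow
  exact fitWindow_of_growthWindow' G r a ha (C := C) hℓ₀ hc hpos hlim hbox hgrow

/-- **Growth windows of H1's shape function from `FitWindow` — registered sub-goal `growthWindow_of_fitWindow` of crux
stmt-QuantumFields-16207 (line `inherited-amplitude-gates`, stub `stub_tame`), closed form.**  For every compact `G`,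
faithful `r`, continuous unit map `a` and H1 witnesses `Γ, β₀, ℓ₀, c, C` (`0 < ℓ₀`, `0 < c`, `a > 0`, `Γ > 0` on
`(0, ℓ₀]`, the verbatim femto-box clause): `FitWindow G r a` implies growth windows of `Γ` at `0⁺`
(`growthWindow_of_fitWindow'`).  With `fitWindow_of_growthWindow`: given H1 and `Continuous a`, `FitWindow` is
equivalent to the growth-window clause of the shape function. -/
theorem growthWindow_of_fitWindow : ∀ (G : Type) [Group G] [TopologicalSpace G] [IsTopologicalGroup G] [CompactSpace G] [MeasurableSpace G] [BorelSpace G] (r : LatticeRep G) (a Γ : ℝ → ℝ) (β₀ ℓ₀ c C : ℝ), Continuous a → 0 < ℓ₀ → 0 < c → (∀ β, 0 < a β) → (∀ s : ℝ, 0 < s → s ≤ ℓ₀ → 0 < Γ s) → (∀ (L : ℕ) [NeZero L] (β : ℝ), β₀ ≤ β → (L : ℝ) * a β ≤ ℓ₀ → let P : (Fin 4 → ZMod L) → Fin 4 → Fin 4 → GaugeConfig 4 L G → ℝ := fun x i j U => (r.N : ℝ) - (r.ρ (plaquetteHolonomy U x i j)).trace.re; let E : (GaugeConfig 4 L G → ℝ)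 → ℝ := fun F => wilsonExpectation (d := 4) (L := L) r.ρ β F; let cov : (GaugeConfig 4 L G → ℝ) → (GaugeConfig 4 L G → ℝ) → ℝ := fun F F' => E (fun U => F U * F' U) - E F * E F'; let dist : (Fin 4 → ZMod L) → (Fin 4 → ZMod L) → ℝ := fun x y => Real.sqrt (∑ k : Fin 4, (((x k - y k).valMinAbs : ℤ) : ℝ) ^ 2); (∀ n : ℕ, 1 ≤ n → 8 * n ≤ L → c * Γ ((n : ℝ) * a β) ≤ (n : ℝ) ^ 8 * cov (P 0 0 1) (P (Pi.single (2 : Fin 4) ((n : ℕ) : ZMod L)) 0 1) ∧ (n : ℝ) ^ 8 * cov (P 0 0 1) (P (Pi.single (2 : Fin 4) ((n : ℕ) : ZMod L)) 0 1) ≤ C * Γ ((n : ℝ) * a β)) ∧ (∀ (x y : Fin 4 → ZMod L) (i j i' j' : Fin 4), x ≠ y → i ≠ j → i' ≠ j' → |cov (P x i j) (P y i' j')| * dist x y ^ 8 ≤ C * Γ (dist x y * a β))) → FitWindow G r a → ∀ K t : ℝ, 0 < t → ∃ s₁ s₂ : ℝ, 0 < s₁ ∧ s₁ < s₂ ∧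 s₂ ≤ t ∧ ∀ s : ℝ, s₁ ≤ s → s ≤ s₂ → K * s ^ 8 ≤ Γ s := by
  intro G _ _ _ _ _ _ r a Γ β₀ ℓ₀ c C ha hℓ₀ hc hpos hΓ hbox hfit
  exact growthWindow_of_fitWindow' G r a ha hℓ₀ hc hpos hΓ hbox hfit

end StubTame

end Summit.QuantumFields.YangMills.Cruxes.OSLegsAtWeakCouplingC.InheritedAmplitudeGates

end
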